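import Summits.BirchSwinnertonDyer.BirchSwinnertonDyer.Theorems.ManinLocalTwoThreeTameUnitTwist

/-!
# If every `Γ₁(N)`-period of a rational newform has plus part `≡ 0 (mod p·Ω⁺_f)` then the plus index is NOT prime to `p`
# (the closing contradiction of the paper edge `TowerExtension.RigidityImpliesTower`, MEMO-an §72.1: `c|Γ₁(N) ≠ 0`)

Summit `BirchSwinnertonDyer`, route `ManinLocalTwoThree` (cell bsd-f2-manin, analytic lens), cruxes C3 `ManinPrimeToThreeAtNine`
(stmt-BirchSwinnertonDyer-22968) / C2 `ManinOddAtFour` (stmt-…-22967).  For a rational newform `f ∈ S₂(Γ₀(N))` write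
`{∞,γ∞}_f + conj = Fc(γ)·Ω⁺_f` (`γ ∈ Γ₀(N)`, `Fc(γ) ∈ ℤ`).  `PlusIndexPrimeTo p f` says that some `Γ₁(N)`-period has plus part
`k·Ω⁺_f` with `p ∤ k`; so the cocycle `γ ↦ Fc(γ) mod p` cannot vanish on `Γ₁(N)`:

* `false_of_gamma1_plusPart_dvd` — if `p ∣ Fc(γ)` for every `γ ∈ Γ₀(N)` with `γ₁₁ ≡ 1 (mod N)`, `γ₁₁ ≠ 0` (these contain `Γ₁(N)`;
  the degenerate `γ₁₁ = 0`, possible only at `N = 1`, is reduced to `(1 0; 1 1)`), then `PlusIndexPrimeTo p f` fails — stated as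
  `False` under both hypotheses (closure induction over `Λ₁(f) = ⟨{∞,γ∞}_f : γ ∈ Γ₁(N)⟩`).

HONEST FRAMING: bookkeeping; nothing about Manin's conjecture or BSD is asserted.  No definitions, no named facts, no sorry.
-/

set_option linter.dupNamespace false
set_option autoImplicit false

noncomputable section

open scoped Classical MatrixGroups ModularForm ComplexConjugate

open CongruenceSubgroup Complex Literature.NumberTheory.EllipticCurves
  Literature.NumberTheory.EllipticCurves.ModularForms
  Summit.BirchSwinnertonDyer.Rank1Residual.ManinAdditive.KatoCurve

namespace Summit.BirchSwinnertonDyer.BirchSwinnertonDyer.Theorems.ManinLocalTwoThree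

variable {N : ℕ} [NeZero N] {f : CuspForm (Gamma0 N) 2}

/-- For `γ ∈ SL(2,ℤ)` with `γ₁₁ = 0` the period `{∞, γ∞}_f` equals `{∞, (1 0; 1 1)∞}_f` (both are `{∞, k}_f = {∞, 0}_f`, `k ∈ ℤ`). -/
theorem cuspSymbol_eq_of_apply_one_one_eq_zero (γ : Gamma0 N) (h : ((γ : SL(2, ℤ)) 1 1 : ℤ) = 0) (T : Gamma0 N)
    (hT00 : ((T : SL(2, ℤ)) 0 0 : ℤ) = 1) (hT10 : ((T : SL(2, ℤ)) 1 0 : ℤ) = 1) :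
    cuspSymbol f γ = cuspSymbol f T := by
  have hdet : ((γ : SL(2, ℤ)) 0 0 : ℤ) * (γ : SL(2, ℤ)) 1 1 - ((γ : SL(2, ℤ)) 0 1 : ℤ) * (γ : SL(2, ℤ)) 1 0 = 1 := by
    have := Matrix.det_fin_two ((γ : SL(2, ℤ)) : Matrix (Fin 2) (Fin 2) ℤ)
    rw [(γ : SL(2, ℤ)).2] at this
    linarith
  rw [h, mul_zero, zero_sub] at hdet
  have hc : ((γ : SL(2, ℤ)) 1 0 : ℤ) ≠ 0 := by
    intro h0; rw [h0, mul_zero, neg_zero] at hdet; exact zero_ne_one hdet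
  have hc1 : ((γ : SL(2, ℤ)) 1 0 : ℤ) = 1 ∨ ((γ : SL(2, ℤ)) 1 0 : ℤ) = -1 := by
    have hu : IsUnit ((γ : SL(2, ℤ)) 1 0 : ℤ) := IsUnit.of_mul_eq_one (-((γ : SL(2, ℤ)) 0 1 : ℤ)) (by linear_combination hdet)
    exact Int.isUnit_iff.mp hu
  -- `γ∞ = γ₀₀/γ₁₀ = ±γ₀₀ ∈ ℤ`
  obtain ⟨k, hk⟩ : ∃ k : ℤ, (((γ : SL(2, ℤ)) 0 0 : ℤ) : ℚ) / (((γ : SL(2, ℤ)) 1 0 : ℤ) : ℚ) = (0 : ℚ) + (k : ℚ) := by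
    rcases hc1 with h1 | h1
    · exact ⟨(γ : SL(2, ℤ)) 0 0, by rw [h1]; push_cast; ring⟩
    · exact ⟨-(γ : SL(2, ℤ)) 0 0, by rw [h1]; push_cast; ring⟩
  have hT : cuspSymbol f T = modularSymbol f 0 := by
    unfold cuspSymbol
    rw [if_neg (by rw [hT10]; exact one_ne_zero), hT00, hT10]
    have : (((1 : ℤ) : ℚ) / ((1 : ℤ) : ℚ)) = (0 : ℚ) + ((1 : ℤ) : ℚ) := by push_cast; ring
    rw [this, modularSymbol_add_intCast_holds f 0 1]
  unfold cuspSymbol at hT ⊢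
  rw [if_neg hc, hk, modularSymbol_add_intCast_holds f 0 k]
  rw [if_neg (by rw [hT10]; exact one_ne_zero)] at hT
  rw [if_neg (by rw [hT10]; exact one_ne_zero), hT]

/-- **The cocycle of plus parts cannot vanish mod `p` on `Γ₁(N)` when the plus index is prime to `p`.**  For a rational newform
`f`, a natural number `p` with `PlusIndexPrimeTo p f`, and integers `Fc(γ)` with `{∞,γ∞}_f + conj = Fc(γ)·Ω⁺_f` (`γ ∈ Γ₀(N)`): it is
impossible that `p ∣ Fc(γ)` for all `γ ∈ Γ₀(N)` with `N ∣ γ₁₁ − 1`, `γ₁₁ ≠ 0`. -/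
theorem false_of_gamma1_plusPart_dvd (hf : IsNewform0 f) (hQ : coeffField f = ⊥) {p : ℕ}
    (hpi : PlusIndexPrimeTo p f) (Fc : SL(2, ℤ) → ℤ)
    (hFc : ∀ (γ : SL(2, ℤ)) (hγ : γ ∈ Gamma0 N),
      cuspSymbol f ⟨γ, hγ⟩ + conj (cuspSymbol f ⟨γ, hγ⟩) = (Fc γ : ℂ) * (plusPeriod f : ℂ))
    (h1 : ∀ γ : SL(2, ℤ), γ ∈ Gamma0 N → (N : ℤ) ∣ γ 1 1 - 1 → (γ 1 1 : ℤ) ≠ 0 → (p : ℤ) ∣ Fc γ) :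
    False := by
  obtain ⟨hpos, -⟩ := plusPeriod_pos_and_realPeriods_eq isZLattice_periodLattice_holds hf hQ
  have hΩ : (plusPeriod f : ℂ) ≠ 0 := by exact_mod_cast hpos.ne'
  -- every generator `{∞, γ∞}_f`, `γ ∈ Γ₁(N)`, has plus part in `pℤ·Ω⁺`
  have hgen : ∀ γ : Gamma1 N, ∃ j : ℤ,
      cuspSymbol f ⟨(γ : SL(2, ℤ)), Gamma1_in_Gamma0 N γ.2⟩ + conj (cuspSymbol f ⟨(γ : SL(2, ℤ)), Gamma1_in_Gamma0 N γ.2⟩) =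
        (j : ℂ) * (plusPeriod f : ℂ) ∧ (p : ℤ) ∣ j := by
    intro γ
    have hγ0 : (γ : SL(2, ℤ)) ∈ Gamma0 N := Gamma1_in_Gamma0 N γ.2
    have hγ1 := (Gamma1_mem N (γ : SL(2, ℤ))).mp γ.2
    have hd1 : (N : ℤ) ∣ (γ : SL(2, ℤ)) 1 1 - 1 := by
      have h := hγ1.2.1
      have h' : (((((γ : SL(2, ℤ)) 1 1 : ℤ) - 1 : ℤ)) : ZMod N) = 0 := by push_cast; rw [h, sub_self]
      exact (ZMod.intCast_zmod_eq_zero_iff_dvd _ N).mp h'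
    by_cases hne : ((γ : SL(2, ℤ)) 1 1 : ℤ) ≠ 0
    · exact ⟨Fc (γ : SL(2, ℤ)), hFc _ hγ0, h1 _ hγ0 hd1 hne⟩
    · push Not at hne
      -- `γ₁₁ = 0` forces `N = 1`; compare with `T = (1 0; 1 1)`
      have hN1 : (N : ℤ) ∣ 1 := by
        rw [hne, zero_sub] at hd1
        exact (dvd_neg).mp hd1
      let T : SL(2, ℤ) := ⟨!![1, 0; 1, 1], by rw [Matrix.det_fin_two_of]; ring⟩
      have hT0 : T ∈ Gamma0 N := by
        rw [Gamma0_mem]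
        show (((1 : ℤ)) : ZMod N) = 0
        exact (ZMod.intCast_zmod_eq_zero_iff_dvd 1 N).mpr hN1
      have hT11 : (T 1 1 : ℤ) = 1 := rfl
      have hpT : (p : ℤ) ∣ Fc T := h1 T hT0 (by rw [hT11, sub_self]; exact dvd_zero _) (by rw [hT11]; exact one_ne_zero)
      have heq := cuspSymbol_eq_of_apply_one_one_eq_zero (f := f) ⟨(γ : SL(2, ℤ)), hγ0⟩ hne ⟨T, hT0⟩ rfl rfl
      refine ⟨Fc T, ?_, hpT⟩
      rw [heq]
      exact hFc T hT0
  -- closure induction over `Λ₁(f)`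
  have hall : ∀ y ∈ periodLatticeGamma1 f, ∃ j : ℤ, y + conj y = (j : ℂ) * (plusPeriod f : ℂ) ∧ (p : ℤ) ∣ j := by
    intro y hy
    induction hy using AddSubgroup.closure_induction with
    | mem z hz =>
      obtain ⟨γ, rfl⟩ := hz
      exact hgen γ
    | zero => exact ⟨0, by simp, dvd_zero _⟩
    | add x y _ _ hx hy =>
      obtain ⟨j₁, hj₁, h₁⟩ := hx
      obtain ⟨j₂, hj₂, h₂⟩ := hy
      refine ⟨j₁ + j₂, ?_, dvd_add h₁ h₂⟩
      rw [map_add, Int.cast_add, add_mul, ← hj₁, ← hj₂]; ring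
    | neg x _ hx =>
      obtain ⟨j, hj, h⟩ := hx
      refine ⟨-j, ?_, (dvd_neg).mpr h⟩
      rw [map_neg, Int.cast_neg, neg_mul, ← hj]; ring
  -- the plus index
  obtain ⟨x₀, hx₀, hx₀Ω⟩ := exists_mem_periodLattice_add_conj_eq_plusPeriod hf hQ
  obtain ⟨y, hy, k, hkp, hk⟩ := hpi x₀ hx₀
  obtain ⟨j, hj, hjp⟩ := hall y hy
  rw [hx₀Ω, hj] at hk
  have hkj : ((k : ℤ) : ℂ) = (j : ℂ) := by exact_mod_cast mul_right_cancel₀ hΩ hk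
  have hkj' : (k : ℤ) = j := by exact_mod_cast hkj
  exact hkp (Int.natCast_dvd_natCast.mp (hkj' ▸ hjp))

end Summit.BirchSwinnertonDyer.BirchSwinnertonDyer.Theorems.ManinLocalTwoThree

end
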